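import Summits.Ventures.HodgeRepro2.T6A2WeilHalg
import Summits.Ventures.HodgeRepro2.T6A1DictHodge2
import Summits.Ventures.HodgeRepro2.T6A1BaseChange

/-!
# T6A2WeilLef2 — the Lefschetz (1,1) binder of `transferShadowWeil` from t6-p1's `alg_lefschetz_HC`

Cell pub-hodge-repro2, Tier 6 (README §10), seat t6-p2 (A2 host side). The binder
`hLef : ∀ a ∈ degB K 2, extC K a ∈ hodge F 1 1 → a ∈ (identB …).algOf 1` of `transferShadowWeil`
(T6A2WeilShadow) from the HC-shaped Lefschetz (1,1) statement t6-p1 proves on the (S4) object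
(`T6A1HostBetti.alg_lefschetz_HC`: a rational degree-2 class of the model of Hodge type `(1,1)` goes under the
degree-2 dictionary `lange2 φ₁ e2` into the base change of the host's `coniveau B 2 1`, from the displays
Lefschetz (1,1) (`Hyp.Lefschetz11_Betti`, through `hLef_of_lefschetz11` and clause (b)) and Lange–Birkenhake
Thm. 1.1.21 (b)), taken here as the binder `h`:
* `extC_ιMulti_two`, `evOf_ofDeg_cupAltW_two`: the degree-2 twins of T6A1ComplexWeil / T6A2WeilHalg;
* **`lange2_extC_evOf_ofDeg`**: the DEGREE-2 COMPATIBILITY of the two dictionaries — for a complex `φ₁`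
  agreeing on the rational points with this seat's `OrderAction.φ₁` transported to the host (`hφ`), t6-p1's
  `lange2 φ₁ e2` at this seat's `e2 = lange2C` sends `extC (ev (ofDeg 1 c))` to `1 ⊗ isoObj c` (checked on the
  spanning two-fold cups, `span_range_cupAltW`, `LinearMap.ext_on`);
* **`hLef_of_lange2_mem`** (the `hLef` binder by name): a model class `a ∈ degB K 2` of type `(1,1)` is
  `ev (ofDeg 1 c)` with `c ∈ H²(B, ℚ)` of the host; `h` puts `1 ⊗ isoObj c` into the base change of
  `coniveau B 2 1`, so `isoObj c ∈ coniveau B 2 1` (`mem_baseChange_mk_one_iff`), so `c` is an algebraic class of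
  `Bd.W` by clause (b) (`hb`), hence `a ∈ algOf 1` (`evOf_ofDeg_mem_algOf`).
No display is consumed: the printed inputs enter as the binders `hL` (Lange), `hb` (clause (b)) and `h`
(t6-p1's theorem). No `sorry`; standard axioms. §8(d): uses an L-value-free non-vanishing device: NO.
-/

noncomputable section

namespace Summit.Ventures.HodgeRepro2.T6.WeilHalg

open HostAPI.Carriers.AlgebraicGeometry.Motives CategoryTheory Opposite
open Summit.Ventures.HodgeRepro2.T6 Summit.Ventures.HodgeRepro2.T6.A2Gysin
open scoped TensorProduct DirectSum
open WeilInst WeilLange Host A1Dict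

variable {K : Type*} [Field K] [NumberField K] (Bd : BettiHodgeData ℂ) (D : SituationData ℂ)
  (A : OrderAction Bd.W D.B K) (hL : Function.Bijective (langeMap Bd.W D.B))

/-- `extC` on a wedge of two rational vectors (the degree-2 twin of `A1ComplexWeil.extC_ιMulti_eq`). -/
theorem extC_ιMulti_two (w : Fin 2 → H1 K) :
    extC K (ExteriorAlgebra.ιMulti ℚ 2 w) = ExteriorAlgebra.ιMulti ℂ 2 (h1ToC K ∘ w) := by
  rw [ExteriorAlgebra.ιMulti_apply, ExteriorAlgebra.ιMulti_apply, map_list_prod, List.map_ofFn]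
  congr 1
  exact congrArg List.ofFn (funext fun i => by simp only [Function.comp_apply, A2Model.extC_ι])

/-- `ev` sends `ofDeg 1` of the cup product `a ∪ b` to the wedge of the `φ₁⁻¹`-images. -/
theorem evOf_ofDeg_cupAltW_two (v : Fin 2 → Bd.W.obj D.B.X 1) :
    evOf Bd.W D A hL (ofDeg Bd.W D.B 1 (cupAltW Bd.W D.B 2 v)) =
      ExteriorAlgebra.ιMulti ℚ 2 (fun i => A.φ₁.symm (v i)) := by
  rw [evOf_apply, evenToFull_ofDeg]
  change ExteriorAlgebra.map (A.φ₁.symm : Bd.W.obj D.B.X 1 →ₗ[ℚ] H1 K)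
    ((langeEquiv Bd.W D hL).symm (ofDegF Bd.W D.B 2
      (langeDegMap Bd.W D.B 2 (exteriorPower.ιMulti ℚ 2 v)))) = _
  rw [← langeMap_eq_ofDegF, ← langeEquiv_apply Bd.W D hL, AlgEquiv.symm_apply_apply,
    exteriorPower.ιMulti_apply_coe, ExteriorAlgebra.map_apply_ιMulti]
  rfl

/-- THE DEGREE-2 COMPATIBILITY of the two dictionaries: t6-p1's `lange2 φ₁ e2` at this seat's `e2 = lange2C`
sends `extC (ev (ofDeg 1 c))` to `1 ⊗ isoObj c`, for every `c ∈ H²(B, ℚ)` of the host. -/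
theorem lange2_extC_evOf_ofDeg (φ₁ : H1C K ≃ₗ[ℂ] HC D.B.X 1)
    (hφ : ∀ w : H1 K, φ₁ (h1ToC K w) = (1 : ℂ) ⊗ₜ[ℚ] Bd.isoObj D.B.X 1 (A.φ₁ w))
    (c : Bd.W.obj D.B.X 2) :
    A1DictHodge2.lange2 φ₁ (lange2C Bd D.B hL) (extC K (evOf Bd.W D A hL (ofDeg Bd.W D.B 1 c))) =
      (1 : ℂ) ⊗ₜ[ℚ] Bd.isoObj D.B.X 2 c := by
  let L : Bd.W.obj D.B.X 2 →ₗ[ℚ] HC D.B.X 2 :=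
    (A1DictHodge2.lange2 φ₁ (lange2C Bd D.B hL)).restrictScalars ℚ ∘ₗ (extC K).toLinearMap ∘ₗ
      (evOf Bd.W D A hL).toLinearMap ∘ₗ ofDeg Bd.W D.B 1
  let R : Bd.W.obj D.B.X 2 →ₗ[ℚ] HC D.B.X 2 :=
    TensorProduct.mk ℚ ℂ (HQ D.B.X 2) 1 ∘ₗ (Bd.isoObj D.B.X 2).toLinearMap
  have hLR : L = R := by
    refine LinearMap.ext_on (span_range_cupAltW Bd.W D.B hL 2) ?_
    rintro _ ⟨v, rfl⟩
    show A1DictHodge2.lange2 φ₁ (lange2C Bd D.B hL)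
        (extC K (evOf Bd.W D A hL (ofDeg Bd.W D.B 1 (cupAltW Bd.W D.B 2 v)))) =
      (1 : ℂ) ⊗ₜ[ℚ] Bd.isoObj D.B.X 2 (cupAltW Bd.W D.B 2 v)
    rw [evOf_ofDeg_cupAltW_two, extC_ιMulti_two, A1DictHodge2.lange2_ιMulti, lange2C_ιMulti]
    simp only [Function.comp_apply, hφ, LinearEquiv.apply_symm_apply]
    show cupMC2 D.B (fun j => (1 : ℂ) ⊗ₜ[ℚ] Bd.isoObj D.B.X 1 (v j)) = _
    rw [cupMC2_tmul, cupAltQ_apply]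
    congr 3
    funext j
    exact LinearEquiv.symm_apply_apply _ _
  exact DFunLike.congr_fun hLR c

/-- **THE LEFSCHETZ (1,1) BINDER OF `transferShadowWeil`, BY NAME**: from the HC-shaped statement `h`
(t6-p1's `alg_lefschetz_HC` at `e2 := lange2C`, from the Lefschetz (1,1) and Thm. 1.1.21 (b) displays),
clause (b) of `Hyp.BettiHodge` at `B` (`hb`) and the seam `hφ`. -/
theorem hLef_of_lange2_mem (hgen : D.HasGens) (hten : D.ProductsSmooth) (F : FaceSetting K)
    (φ₁ : H1C K ≃ₗ[ℂ] HC D.B.X 1)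
    (hφ : ∀ w : H1 K, φ₁ (h1ToC K w) = (1 : ℂ) ⊗ₜ[ℚ] Bd.isoObj D.B.X 1 (A.φ₁ w))
    (hb : ∀ p : ℕ, Bd.W.algebraicClasses D.B.X p =
      (coniveau D.B.X (2 * p) p).comap (Bd.isoObj D.B.X (2 * p)).toLinearMap)
    (h : ∀ a ∈ degB K 2, extC K a ∈ hodge F 1 1 →
      A1DictHodge2.lange2 φ₁ (lange2C Bd D.B hL) (extC K a) ∈ (coniveau D.B.X 2 1).baseChange ℂ) :
    ∀ a ∈ degB K 2, extC K a ∈ hodge F 1 1 → a ∈ (identB Bd.W D hgen hten A hL).algOf 1 := by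
  intro a ha hH
  obtain ⟨c, hc⟩ := evF_symm_mem_range_ofDegF Bd.W D A hL ha
  have hac : a = evOf Bd.W D A hL (ofDeg Bd.W D.B 1 c) := by
    rw [evOf_eq_evF, evenToFull_ofDeg]
    change a = evF Bd.W D A hL (ofDegF Bd.W D.B 2 c)
    rw [hc, AlgEquiv.apply_symm_apply]
  have h1 := h a ha hH
  rw [hac, lange2_extC_evOf_ofDeg Bd D A hL φ₁ hφ c] at h1
  have h2 : Bd.isoObj D.B.X 2 c ∈ coniveau D.B.X 2 1 :=
    (A1BaseChange.mem_baseChange_mk_one_iff _ _).1 h1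
  have h3 : c ∈ Bd.W.algebraicClasses D.B.X 1 := by
    rw [hb 1]
    exact Submodule.mem_comap.2 h2
  rw [hac]
  exact evOf_ofDeg_mem_algOf Bd.W D hgen hten A hL ((mem_algebraicClasses_iff Bd.W D.B 1 c).1 h3)

end Summit.Ventures.HodgeRepro2.T6.WeilHalg

end
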